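import Mathlib
import Literature.Analysis.Calculus.InversePowerSeries

/-!
# Crux `UniformPhotonSphereChannelsR` (K1R, stmt-FinalStateConjecture-14074), line
# `crum-peeling-recessive-tower` — series lemmas for the analytic stubs C₁ (`stub_seriesChain`) and
# B (`stub_shiftFromCoeffs`) of skeleton v4

Supplements to the inverse-power-series toolkit `Literature.Analysis.Calculus.InversePowerSeries`
(p106275; `ipsEval c y = Σ cₙ y⁻ⁿ` under `GeomBound c C K : |cₙ| ≤ C Kⁿ`), namespace `…IPS`:

* `ipsEval_eq_head_add` (`Σ cₙ y⁻ⁿ = c₀ + y⁻¹ Σ cₙ₊₁ y⁻ⁿ`), `geomBound_succ`, `geomBound_pred`,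
  `ipsEval_pred` (right shift), `abs_ipsEval_le_of_head_zero` (a series vanishing to order `m` is
  `O(y⁻ᵐ)` with the explicit constant `C Kᵐ y⁻ᵐ · y/(y−K)`);
* the Euler operator on coefficients: `mul_ipsEval_ipsDeriv` (`y Σ(∂c)ₙ y⁻ⁿ = Σ (−n cₙ) y⁻ⁿ`),
  `hasDerivAt_mul_ipsEval` (`(y Σ cₙ y⁻ⁿ)′ = Σ (1−n) cₙ y⁻ⁿ`), `ipsEval_succ_mul`
  (`Σ (n+1)cₙ y⁻ⁿ = Σ cₙ y⁻ⁿ − y Σ (∂c)ₙ y⁻ⁿ`), with the bounds `geomBound_neg_mul`, `geomBound_succ_mul`;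
* `ipsEval_indicator_zero` (`Σ [n=0] y⁻ⁿ = 1`).

and, namespace `…ShiftCoeffs`, the small-context arithmetic of stub B: `numeric_core` (interval
arithmetic at `z ≥ 200`, `R ≥ 1`), `clauses_of_shift`, `deriv_clause`, `cast_le_two_pow`,
`cast_sq_le_two_pow_succ`.
-/

-- `Summit.<S>.<S>` repeats a namespace component by design (D-0017); off here as in the lakefile.
set_option linter.dupNamespace false

noncomputable section

open Literature.Analysis.Calculus Filter Topology Finset

namespace Summit.FinalStateConjecture.FinalStateConjecture.Theorems.CrumPeelingRecessiveTower

namespace IPS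

variable {c : ℕ → ℝ} {C K y : ℝ}

/-! ### Generic supplements to the inverse-power-series toolkit -/

/-- A geometric bound survives enlarging the ratio. -/
theorem geomBound_of_le (hc : GeomBound c C K) {K' : ℝ} (h : K ≤ K') : GeomBound c C K' :=
  ⟨hc.1, hc.2.1.trans h, fun n =>
    (hc.2.2 n).trans (mul_le_mul_of_nonneg_left (pow_le_pow_left₀ hc.2.1 h n) hc.1)⟩

/-- The shifted sequence `n ↦ c (n+1)` obeys the bound with constant `C K`. -/
theorem geomBound_succ (hc : GeomBound c C K) : GeomBound (fun n => c (n + 1)) (C * K) K := by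
  refine ⟨mul_nonneg hc.1 hc.2.1, hc.2.1, fun n => ?_⟩
  have := hc.2.2 (n + 1)
  rw [pow_succ] at this
  linarith [this]

/-- **Shift identity**: `Σ cₙ y⁻ⁿ = c₀ + y⁻¹ Σ c_{n+1} y⁻ⁿ` for `y > K`. -/
theorem ipsEval_eq_head_add (hc : GeomBound c C K) (hy : K < y) :
    ipsEval c y = c 0 + y⁻¹ * ipsEval (fun n => c (n + 1)) y := by
  unfold ipsEval
  rw [(summable_ips hc hy).tsum_eq_zero_add, ← tsum_mul_left]
  congr 1
  · simp
  · refine tsum_congr fun n => ?_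
    rw [pow_succ]
    ring

/-- **Vanishing head ⇒ higher-order smallness**: if `c i = 0` for `i < m` then
`|Σ cₙ y⁻ⁿ| ≤ C Kᵐ y⁻ᵐ · y/(y − K)` for `y > K`. -/
theorem abs_ipsEval_le_of_head_zero (m : ℕ) :
    ∀ {c : ℕ → ℝ} {C : ℝ}, GeomBound c C K → K < y → (∀ i, i < m → c i = 0) →
      |ipsEval c y| ≤ C * K ^ m * y⁻¹ ^ m * (y / (y - K)) := by
  induction m with
  | zero =>
    intro c C hc hy _
    simpa using abs_ipsEval_le hc hy
  | succ m ih =>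
    intro c C hc hy hz
    have hy0 : 0 < y := lt_of_le_of_lt hc.2.1 hy
    rw [ipsEval_eq_head_add hc hy, hz 0 (Nat.succ_pos m), zero_add, abs_mul,
      abs_of_pos (inv_pos.2 hy0)]
    have h := ih (geomBound_succ hc) hy (fun i hi => hz (i + 1) (by omega))
    calc y⁻¹ * |ipsEval (fun n => c (n + 1)) y|
        ≤ y⁻¹ * (C * K * K ^ m * y⁻¹ ^ m * (y / (y - K))) :=
          mul_le_mul_of_nonneg_left h (inv_nonneg.2 hy0.le)
      _ = C * K ^ (m + 1) * y⁻¹ ^ (m + 1) * (y / (y - K)) := by rw [pow_succ, pow_succ]; ring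

/-- `y · Σ (∂c)ₙ y⁻ⁿ = Σ (−n cₙ) y⁻ⁿ` for `y > K` (the Euler operator `y d/dy` on coefficients). -/
theorem mul_ipsEval_ipsDeriv (hc : GeomBound c C K) (hy : K < y) :
    y * ipsEval (ipsDeriv c) y = ipsEval (fun n => -(n : ℝ) * c n) y := by
  have hy0 : 0 < y := lt_of_le_of_lt hc.2.1 hy
  -- summability of the derivative series at `y` via an intermediate ratio
  set K' : ℝ := (K + y) / 2 with hK'
  have hKK' : K < K' := by rw [hK']; linarith
  have hK'y : K' < y := by rw [hK']; linarith
  have hG := geomBound_ipsDeriv hc hKK'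
  rw [ipsEval_eq_head_add hG hK'y]
  have h0 : ipsDeriv c 0 = 0 := rfl
  rw [h0, zero_add, ← mul_assoc, mul_inv_cancel₀ hy0.ne', one_mul]
  unfold ipsEval
  refine tsum_congr fun n => ?_
  simp [ipsDeriv]

/-- The coefficients `−n cₙ` obey a geometric bound at any larger ratio. -/
theorem geomBound_neg_mul (hc : GeomBound c C K) {K' : ℝ} (hKK' : K < K') :
    GeomBound (fun n => -(n : ℝ) * c n) (C * (K' / (K' - K))) K' := by
  have hK' : 0 < K' := lt_of_le_of_lt hc.2.1 hKK'
  refine ⟨mul_nonneg hc.1 (div_nonneg hK'.le (by linarith)), hK'.le, fun n => ?_⟩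
  rw [abs_mul, abs_neg, Nat.abs_cast]
  have h1 : (n : ℝ) * |c n| ≤ C * (((n : ℝ) + 1) * K ^ n) := by
    have := hc.2.2 n
    have hn : (0 : ℝ) ≤ n := Nat.cast_nonneg n
    nlinarith [abs_nonneg (c n)]
  calc (n : ℝ) * |c n| ≤ C * (((n : ℝ) + 1) * K ^ n) := h1
    _ ≤ C * ((K' / (K' - K)) * K' ^ n) :=
        mul_le_mul_of_nonneg_left (succ_mul_pow_le hc.2.1 hKK' n) hc.1
    _ = C * (K' / (K' - K)) * K' ^ n := by ring

/-- **Euler product rule**: `d/dy (y · Σ cₙ y⁻ⁿ) = Σ (1 − n) cₙ y⁻ⁿ` for `y > K`. -/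
theorem hasDerivAt_mul_ipsEval (hc : GeomBound c C K) (hy : K < y) :
    HasDerivAt (fun t => t * ipsEval c t) (ipsEval (fun n => (1 - (n : ℝ)) * c n) y) y := by
  have h1 : HasDerivAt (fun t => t * ipsEval c t)
      (1 * ipsEval c y + y * ipsEval (ipsDeriv c) y) y :=
    (hasDerivAt_id y).mul (hasDerivAt_ipsEval hc hy)
  convert h1 using 1
  rw [one_mul, mul_ipsEval_ipsDeriv hc hy]
  -- both sides are sums of series converging at `y`; compare termwise at a ratio between `K` and `y`
  set K' : ℝ := (K + y) / 2 with hK'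
  have hKK' : K < K' := by rw [hK']; linarith
  have hK'y : K' < y := by rw [hK']; linarith
  have hcK' : GeomBound c C K' := geomBound_of_le hc hKK'.le
  have hneg := geomBound_neg_mul hc hKK'
  rw [← ipsEval_add hcK' hneg hK'y]
  congr 1
  funext n
  ring

/-- The indicator of `0` sums to `1`: `Σ [n = 0] y⁻ⁿ = 1`. -/
theorem ipsEval_indicator_zero (y : ℝ) :
    ipsEval (fun n => if n = 0 then (1 : ℝ) else 0) y = 1 := by
  unfold ipsEval
  rw [tsum_eq_single 0]
  · simp
  · intro n hn
    simp [hn]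

/-- The **right shift** `n ↦ [n ≠ 0] c_{n−1}` obeys the same bound once `K ≥ 1`. -/
theorem geomBound_pred (hc : GeomBound c C K) (hK : 1 ≤ K) :
    GeomBound (fun n => if n = 0 then 0 else c (n - 1)) C K := by
  refine ⟨hc.1, hc.2.1, fun n => ?_⟩
  cases n with
  | zero => simp only [if_true, abs_zero]; exact mul_nonneg hc.1 (pow_nonneg hc.2.1 _)
  | succ m =>
    simp only [Nat.succ_ne_zero, if_false, Nat.add_sub_cancel]
    calc |c m| ≤ C * K ^ m := hc.2.2 m
      _ ≤ C * K ^ (m + 1) := by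
          rw [pow_succ]
          exact mul_le_mul_of_nonneg_left (le_mul_of_one_le_right (pow_nonneg hc.2.1 m) hK) hc.1

/-- **Right-shift identity**: `Σ [n ≠ 0] c_{n−1} y⁻ⁿ = y⁻¹ Σ cₙ y⁻ⁿ` for `y > K ≥ 1`. -/
theorem ipsEval_pred (hc : GeomBound c C K) (hK : 1 ≤ K) (hy : K < y) :
    ipsEval (fun n => if n = 0 then 0 else c (n - 1)) y = y⁻¹ * ipsEval c y := by
  rw [ipsEval_eq_head_add (geomBound_pred hc hK) hy]
  simp

/-- The coefficients `(n+1) cₙ` obey a geometric bound at any larger ratio. -/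
theorem geomBound_succ_mul (hc : GeomBound c C K) {K' : ℝ} (hKK' : K < K') :
    GeomBound (fun n => ((n : ℝ) + 1) * c n) (C * (K' / (K' - K))) K' := by
  have hK' : 0 < K' := lt_of_le_of_lt hc.2.1 hKK'
  refine ⟨mul_nonneg hc.1 (div_nonneg hK'.le (by linarith)), hK'.le, fun n => ?_⟩
  rw [abs_mul, abs_of_nonneg (by positivity : (0 : ℝ) ≤ (n : ℝ) + 1)]
  calc ((n : ℝ) + 1) * |c n| ≤ ((n : ℝ) + 1) * (C * K ^ n) :=
        mul_le_mul_of_nonneg_left (hc.2.2 n) (by positivity)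
    _ = C * (((n : ℝ) + 1) * K ^ n) := by ring
    _ ≤ C * ((K' / (K' - K)) * K' ^ n) :=
        mul_le_mul_of_nonneg_left (succ_mul_pow_le hc.2.1 hKK' n) hc.1
    _ = C * (K' / (K' - K)) * K' ^ n := by ring

/-- `Σ (n+1) cₙ y⁻ⁿ = Σ cₙ y⁻ⁿ − y · Σ (∂c)ₙ y⁻ⁿ` for `y > K`. -/
theorem ipsEval_succ_mul (hc : GeomBound c C K) (hy : K < y) :
    ipsEval (fun n => ((n : ℝ) + 1) * c n) y = ipsEval c y - y * ipsEval (ipsDeriv c) y := by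
  rw [mul_ipsEval_ipsDeriv hc hy]
  set K' : ℝ := (K + y) / 2 with hK'
  have hKK' : K < K' := by rw [hK']; linarith
  have hK'y : K' < y := by rw [hK']; linarith
  have hsucc := geomBound_succ_mul hc hKK'
  have hneg : GeomBound (fun n => -(n : ℝ) * c n) (C * (K' / (K' - K))) K' := by
    refine ⟨hsucc.1, hsucc.2.1, fun n => (le_trans ?_ (hsucc.2.2 n))⟩
    rw [abs_mul, abs_mul, abs_neg, Nat.abs_cast, abs_of_nonneg (by positivity : (0 : ℝ) ≤ (n : ℝ) + 1)]
    exact mul_le_mul_of_nonneg_right (by linarith) (abs_nonneg _)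
  rw [eq_sub_iff_add_eq, ← ipsEval_add hsucc hneg hK'y]
  congr 1
  funext n
  ring

end IPS

namespace ShiftCoeffs

/-! ### Two elementary growth facts -/

/-- `n ≤ 2ⁿ` over `ℝ`. -/
theorem cast_le_two_pow (n : ℕ) : (n : ℝ) ≤ 2 ^ n := by
  exact_mod_cast (Nat.lt_two_pow_self).le

/-- `n² ≤ 2ⁿ⁺¹` over `ℝ`. -/
theorem cast_sq_le_two_pow_succ (n : ℕ) : (n : ℝ) ^ 2 ≤ 2 ^ (n + 1) := by
  have key : ∀ m : ℕ, m ^ 2 ≤ 2 ^ (m + 1) := by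
    intro m
    induction m with
    | zero => norm_num
    | succ k ih =>
      have hk : k < 2 ^ k := Nat.lt_two_pow_self
      have e1 : (k + 1) ^ 2 = k ^ 2 + (2 * k + 1) := by ring
      have e2 : 2 ^ (k + 1 + 1) = 2 * 2 ^ (k + 1) := by ring
      have e3 : 2 ^ (k + 1) = 2 * 2 ^ k := by ring
      rw [e1, e2]
      rw [e3] at ih ⊢
      omega
  exact_mod_cast key n

/-! ### The numeric core: interval arithmetic at `t ≥ 200`, `R ≥ 1` -/

/-- **Numeric core.**  With `f = 1 − 2/(R t)`, `g` within `1/(t−1)` of `1`, `e` within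
`4/(R t (t−2))` of `1` and `|d| ≤ 8/(R t² (t−2))` (`t ≥ 200`, `R ≥ 1`):  `g > 0`, `0 < f`,
`1/2 ≤ f e ≤ 1`, `64 (1 − f e) ≤ 1` and `0 < 2 f e/(R² t²) + f² d/R`. -/
theorem numeric_core {R t g e d : ℝ} (hR : 1 ≤ R) (ht : 200 ≤ t)
    (hg : |g - 1| ≤ 1 / (t - 1)) (he : |e - 1| ≤ 4 / (R * t * (t - 2)))
    (hd : |d| ≤ 8 / (R * t ^ 2 * (t - 2))) :
    0 < g ∧ 0 < 1 - 2 / (R * t) ∧ (1 - 2 / (R * t)) * e ≤ 1 ∧ 1 / 2 ≤ (1 - 2 / (R * t)) * e ∧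
      64 * (1 - (1 - 2 / (R * t)) * e) ≤ 1 ∧
      0 < 2 * (1 - 2 / (R * t)) / (R ^ 2 * t ^ 2) * e + (1 - 2 / (R * t)) ^ 2 * d / R := by
  have hR0 : 0 < R := by linarith
  have ht0 : 0 < t := by linarith
  have hRt : 0 < R * t := mul_pos hR0 ht0
  -- the small parameter `a = 1/(R t) ∈ (0, 1/200]`
  set a : ℝ := 1 / (R * t) with ha
  have ha0 : 0 < a := by rw [ha]; positivity
  have ha1 : a ≤ 1 / 200 := by
    rw [ha, div_le_div_iff₀ hRt (by norm_num : (0:ℝ) < 200), one_mul]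
    nlinarith
  have hf : 1 - 2 / (R * t) = 1 - 2 * a := by rw [ha]; ring
  -- `g`
  have hg' : |g - 1| ≤ 1 / 199 := hg.trans (by
    rw [div_le_div_iff₀ (by linarith) (by norm_num : (0:ℝ) < 199)]; linarith)
  have hg1 : 0 < g := by
    have := (abs_le.1 hg').1; linarith
  -- `e`: `|e − 1| ≤ a · 4/(t−2) ≤ a/49`
  have he' : |e - 1| ≤ a / 49 := by
    refine he.trans ?_
    have ht2 : 0 < t - 2 := by linarith
    rw [ha, show 4 / (R * t * (t - 2)) = (1 / (R * t)) * (4 / (t - 2)) by field_simp]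
    rw [show 1 / (R * t) / 49 = (1 / (R * t)) * (1 / 49) by ring]
    refine mul_le_mul_of_nonneg_left ?_ (by positivity)
    rw [div_le_div_iff₀ ht2 (by norm_num : (0:ℝ) < 49)]
    linarith
  obtain ⟨he1, he2⟩ := abs_le.1 he'
  -- `d`: `|d| ≤ 8 a² R/(t − 2) ≤ a² R · (8/198)`
  have hd' : |d| ≤ a ^ 2 * R * (8 / 198) := by
    refine hd.trans ?_
    have ht2 : 0 < t - 2 := by linarith
    have e1 : 8 / (R * t ^ 2 * (t - 2)) = a ^ 2 * R * (8 / (t - 2)) := by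
      rw [ha]; field_simp
    rw [e1]
    refine mul_le_mul_of_nonneg_left ?_ (by positivity)
    rw [div_le_div_iff₀ ht2 (by norm_num : (0:ℝ) < 198)]
    linarith
  obtain ⟨hd1, hd2⟩ := abs_le.1 hd'
  have hf0 : 0 < 1 - 2 * a := by linarith
  have hf1 : 1 - 2 * a ≤ 1 := by linarith
  refine ⟨hg1, by rw [hf]; exact hf0, ?_, ?_, ?_, ?_⟩
  · rw [hf]; nlinarith
  · rw [hf]; nlinarith
  · rw [hf]; nlinarith
  · rw [hf]
    have e2 : 2 * (1 - 2 * a) / (R ^ 2 * t ^ 2) * e = 2 * (1 - 2 * a) * a ^ 2 * e := by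
      rw [ha]; field_simp
    rw [e2]
    -- lower bounds for the two terms
    have h1 : 2 * (1 - 2 * a) * a ^ 2 * (48 / 49) ≤ 2 * (1 - 2 * a) * a ^ 2 * e := by
      refine mul_le_mul_of_nonneg_left (by linarith) (by positivity)
    have h2 : -((1 - 2 * a) ^ 2 * (a ^ 2 * R * (8 / 198)) / R) ≤ (1 - 2 * a) ^ 2 * d / R := by
      rw [neg_le, ← neg_div, ← mul_neg]
      refine div_le_div_of_nonneg_right ?_ hR0.le
      exact mul_le_mul_of_nonneg_left (by linarith) (by positivity)
    have h3 : (1 - 2 * a) ^ 2 * (a ^ 2 * R * (8 / 198)) / R = (1 - 2 * a) ^ 2 * a ^ 2 * (8 / 198) := by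
      field_simp
    rw [h3] at h2
    have h4 : (1 - 2 * a) ^ 2 * a ^ 2 * (8 / 198) ≤ (1 - 2 * a) * a ^ 2 * (8 / 198) := by
      have : (1 - 2 * a) ^ 2 ≤ (1 - 2 * a) := by nlinarith
      nlinarith [sq_nonneg a]
    have h5 : 0 < (1 - 2 * a) * a ^ 2 := by positivity
    nlinarith


/-! ### The final algebra, in a small context -/

/-- The four pointwise clauses from `W = −iD`, `U = (1 + D′) iD²`, `1/2 ≤ D′ ≤ 1`, `64(1 − D′) ≤ 1`. -/
theorem clauses_of_shift {Wx Ux D1 iD : ℝ} (hiD : 0 < iD) (hW : Wx = -iD)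
    (hU : Ux = (1 + D1) * (iD * iD)) (hle : D1 ≤ 1) (hge : 1 / 2 ≤ D1) (h64 : 64 * (1 - D1) ≤ 1) :
    Wx < 0 ∧ Ux ≤ 2 * Wx ^ 2 ∧ Wx ^ 2 ≤ 2 * (Ux - Wx ^ 2) ∧ 64 * (2 * Wx ^ 2 - Ux) ≤ Wx ^ 2 := by
  have hii : 0 < iD * iD := mul_pos hiD hiD
  subst hW hU
  have p1 := mul_le_mul_of_nonneg_right hle hii.le
  have p2 := mul_le_mul_of_nonneg_right hge hii.le
  have p3 := mul_le_mul_of_nonneg_right h64 hii.le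
  refine ⟨by linarith, ?_, ?_, ?_⟩
  · nlinarith [p1]
  · nlinarith [p2]
  · nlinarith [p3]

/-- The derivative clause: `4W(U − W²) − U′ = −D″ iD² − 2D′(1 − D′) iD³ ≤ 0`. -/
theorem deriv_clause {D1 D2 iD : ℝ} (hiD : 0 < iD) (hle : D1 ≤ 1) (hge : 0 ≤ D1) (hD2 : 0 ≤ D2) :
    4 * -iD * (D1 * iD ^ 2) -
        (D2 * (iD * iD) + (1 + D1) * (-D1 * iD ^ 2 * iD + iD * (-D1 * iD ^ 2))) ≤ 0 := by
  have key : 4 * -iD * (D1 * iD ^ 2) -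
      (D2 * (iD * iD) + (1 + D1) * (-D1 * iD ^ 2 * iD + iD * (-D1 * iD ^ 2)))
      = -(D2 * iD ^ 2) - 2 * (D1 * (1 - D1)) * iD ^ 3 := by ring
  rw [key]
  have h1 : 0 ≤ D2 * iD ^ 2 := by positivity
  have h2 : 0 ≤ D1 * (1 - D1) := mul_nonneg hge (by linarith)
  have h3 : 0 ≤ 2 * (D1 * (1 - D1)) * iD ^ 3 := by positivity
  linarith

end ShiftCoeffs

/-- Registered sub-goal `series_indicator_eval` of `stub_seriesChain`/`stub_shiftFromCoeffs`
(verbatim signature): the indicator of `0` sums to `1` as an inverse power series — the evaluated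
form of the inversion relation `g · ω = 1` used by both analytic stubs. -/
theorem series_indicator_eval : ∀ y : ℝ, Literature.Analysis.Calculus.ipsEval (fun n => if n = 0 then (1 : ℝ) else 0) y = 1 :=
  IPS.ipsEval_indicator_zero

end Summit.FinalStateConjecture.FinalStateConjecture.Theorems.CrumPeelingRecessiveTower

end
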